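/-
Copyright: statement-level skeleton of a published paper (lit-balaban cell, Phase-2 proof seat p39 gen 10). No proof claims
beyond what the kernel checks below.
-/
import Literature.MathematicalPhysics.QuantumFieldTheory.Balaban1983to89.B3Pi3CxiTorusBounded
import Literature.MathematicalPhysics.QuantumFieldTheory.Balaban1983to89.B3Eq317ZeroTorus

/-!
# B3 — T. Bałaban, *(Higgs)₂,₃ quantum fields in a finite volume. III. Renormalization*, CMP **88** (1983) 411–445
[Balaban1983Higgs3], p. 442 [PDF 32], the sentence after **(3.30)** — *"where the coefficient at the vertex [Π_{μμ′ν}] is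
bounded, and the coefficient at the vertex [Π_{μμ′}] is proportional to (L^{j₀}η)^{−d+2}, and j₀ is the lowest j-index of the
external legs"* — PROVED ON THE η-LATTICE at the zero-field TORUS MODEL INSTANCE (`d = 3`, `A = B̃ = 0`, `Ω = T_η`), together
with the p. 440/441 resummation sentence *"If j₀ denotes a smallest j-index of external legs, then we sum with respect to j, j′,
j″ from 0 to j₀ and we get the same expressions but with the propagator G_{j₀}(0)"* at the instance

statement-level skeleton of published theorems with citation tags; proofs where landed; nothing here is a claim about
the Yang–Mills mass gap

PDF held: `paper:balaban1983-higgs-2-3-quantum-fields-finite-volume` (journal page = PDF page + 410); pp. 440–442 [PDF 30–32] read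
on the ×2 renders `run/shared/lean/pub/pub-balaban/b2b-balaban-ref1/pages/1983-cmp88-higgs23-III/1983-cmp88-higgs23-III-p030-x2.png`
… `-p032-x2.png` and in the OCR text (`p0030.txt` … `p0032.txt`).  Row **B3.Eq3.25-3.32** of `HOME/lit-balaban-r15/ROWS-B3.md`
(fold owner r15).  CONTEXT.  Gens 7–8 of this seat proved the two halves of the quoted sentence for the RESCALED functions
`Π^{(ξ,j₀)}_{μμ′}`, `Π^{(ξ,j₀)}_{μμ′ν}` on the `ξ = L^{−j₀}` lattice (`B3Pi2CxiTorusBounded.abs_Pi2_G0xi_le`,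
`B3Pi3CxiTorusBounded.abs_Pi3_G0xi_le`: both `≤ Cst·|tr q²|` uniformly in the volume and the scale), and r15 proved the printed
rescaling identities `Π^{(η,j₀)}_{μμ′}(x) = (L^{j₀}η)^{−d+2}Π^{(ξ,j₀)}_{μμ′}(y)`, `Π^{(η,j₀)}_{μμ′ν}(x) = (L^{j₀}η)^{−d+3}Π^{(ξ,j₀)}_{μμ′ν}(y)`
from free-propagator scaling hypotheses (`B3Sect3VectorSelfEnergy.Pi2_rescale`, `Pi3_rescale`).  THIS FILE discharges those
hypotheses at the instance — the η-lattice kernel of `G_{j₀}(0)` is the resummed sum of the Sect.-3 pieces `Σ_{j<j₀}G^η_{(j)}` (p20's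
`B3Sect3KernelsZeroTorus.gpiece`, `= η^{−d}G_{j₀}(T_η,0)` by (2.6), `B3Eq317ZeroTorus.sum_gpiece_eq_G`) and `G^ξ_{j₀}(0) =
(L^{j₀}η)^{d−2}·Σ_{j<j₀}G^η_{(j)}` (`B3Eq317ZeroTorus.G0xi_eq_rescaled`), the displacement rescales by `B3Eq317ZeroTorus.disp_rescale`
— and states the quoted sentence where the rest of Sect. 3 lives, on the η-lattice, following p20 gen 6's pattern for (3.17)/(3.23)
(`B3Eq317ZeroTorus`, `B3Eq323EtaZeroTorus`).  Nothing is re-proved: the bounds are gens 7–8's, the identities r15's and p20's.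
WHAT IS PROVED (`s = L^kε = P.spacing k`, `ξ = L^{−k} = P.eta k`, `η = ε = P.eps = sξ`; `G^η_k(0) := Σ_{i<k} gpiece k i`):
* §1 RESCALING (any `d ≥ 2`, any volume, `k ≥ 1`): `sum_gpiece_eq_smul_G0xi` (`G^η_k(0) = s²/s^d·G^ξ_k(0)` — the free-propagator
  scaling hypothesis of `Pi2_rescale`), `disp_eta_eq` (`x′_ν − x_ν = s·(y′_ν − y_ν)`), **`Pi2_eta_eq`** (`Π^{(η,k)}_{μμ′}(x) =
  s²/s^d·Π^{(ξ,k)}_{μμ′}(y)`), **`Pi3_eta_eq`** (`Π^{(η,k)}_{μμ′ν}(x) = s³/s^d·Π^{(ξ,k)}_{μμ′ν}(y)`); in `d = 3`: `Pi2_eta_eq_three`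
  (factor `(L^kε)^{−1}`), `Pi3_eta_eq_three` (factor `1`) — p. 441 *"We consider the case d = 3, so −d+2 = −1, −d+3 = 0"*.
* §2 **THE TWO COEFFICIENTS ON THE η-LATTICE, d = 3**: `abs_Pi2_eta_le` — for odd `L > 1`, `a > 0`, `m² ≥ 0` there is `Cst` with
  `|Π^{(η,k)}_{μμ′}(x)| ≤ Cst·(L^kε)^{−1}·|tr q²|` for every volume `P = (3,L,m,K)`, every `1 ≤ k ≤ K`, all `μ, μ′, x` — *"proportional to
  (L^{j₀}η)^{−d+2}"* with a factor bounded uniformly in the volume and the scale (`Pi2_eta_eq_bounded`: `Π^{(η,k)}_{μμ′}(x) =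
  (L^kε)^{−1}·B`, `|B| ≤ Cst|tr q²|`); `abs_Pi3_eta_le` — `|Π^{(η,k)}_{μμ′ν}(x)| ≤ Cst·|tr q²|` — *"the coefficient at the vertex
  [Π_{μμ′ν}] is bounded"*.
* §3 **`eq330_coefficients_zero_torus`** — the p. 440/441 resummation AND the two bounds at the instance, one constant for all
  volumes and scales: (a) `Σ_{i,i′<k}Σ_{x′}η^d kerC[G^η_{(i)},G^η_{(i′)}] − Σ_{i″<k}(local terms of G^η_{(i″)}) = Π^{(η,k)}_{μμ′}[G^η_k(0)]`
  (`B3Resummation315.Pi2_resum`), (b) `Σ_{i,i′<k}Π_{μμ′ν}[G^η_{(i)},G^η_{(i′)}] = Π^{(η,k)}_{μμ′ν}[G^η_k(0)]` (`Pi3_resum`), (c) the bounds of §2.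
* §4 THE TWO VERTICES OF (3.30) (the square bracket and the first curly bracket of (3.26) with the propagator `G^η_k(0)`, r15's
  `bracket326_eq_Pi2` / `curly1_eq_Pi3`): `abs_bracket326_eta_le` — `|[…]| ≤ Cst·(L^kε)^{−1}·|tr q²|·Σ_xη³Σ_{μμ′}|gA_μ(x)||g′A′_{μ′}(x)|`,
  `abs_curly1_eta_le` — `|{…}₁| ≤ Cst·|tr q²|·Σ_νΣ_xη³Σ_{μμ′}|gA_μ(x)||D_{νμ′}(x)|` for every leg reading `D` (in print `∂^η_ν(g′A′_{μ′})`).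
HONEST SCOPE: `d = 3` for §2–§4; `A = B̃ = 0`, `U ≡ 1`, `Ω` = the whole torus (the scope of the zero-field tower
`B1RG242Torus.tower`); all three propagator slots carry the same scalar zero-field propagator `G_k(0)` (the printed Π-functions
after the resummation); fixed `a > 0`, `m² ≥ 0`, constants existential and uniform in the volume `(m, K)` and in `1 ≤ k ≤ K`; the
displacement `(x′_ν − x_ν)` is the contour displacement `B3Taylor310Remainder.disp` of (3.10)/(3.26).  The PICTURES of (3.30)
(the graphical equation itself, the `(1+α)`-subtracted generalized graphs) are not typed; this file proves the sentence about
the two coefficients.  Mathlib + the cited tree files only; theorems only, no definitions, no named facts; standard axioms.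
Unit `lit-balaban-p39-g10` (Phase-2 proof seat p39, gen 10), HOME `run/shared/lean/pub/lit-balaban/`, 2026-08-22.
v1.1 (docstrings only, CITELOC P45-003 of summit-lit1 gen 45): the display (3.26) is printed on p. 440 (p. 441 carries the
rescaling sentences) — six `[cite: …, (3.26) p.441]` tags corrected to `(3.26) p.440, rescaling p.441`; no declaration changed.
-/

open scoped BigOperators

namespace Literature.MathematicalPhysics.QuantumFieldTheory.Balaban1983to89.B3Eq330EtaZeroTorus

open Finset B1RG242Torus B3Sect3KernelsZeroTorus B3GkZeroTorusRescaled B3Eq317ZeroTorus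
open LatticeFieldCalculus B3Sect3ScalarSelfEnergy B3Sect3VectorSelfEnergy B3Resummation315
open B3Taylor310Remainder (disp)

noncomputable section

variable {P : Params}

/-! ## §1 Rescaling of `Π_{μμ′}`, `Π_{μμ′ν}` from the η-lattice to the `L^{−j₀}`-lattice (p. 441) at the instance -/

section Rescaling

/-- p. 441 rescaling, the propagator: the η-lattice kernel `G^η_k(0) = Σ_{j<k}G^η_{(j)}` is `(L^kε)^{2−d}·G^ξ_k(0)` — the
free-propagator scaling hypothesis `G^η(0)(x,x′) = (L^{j₀}η)^{−d+2}G^ξ(0)(y,y′)` of r15's `Pi2_rescale`, `(L^{j₀}η)^{−d+2} = s²/s^d`,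
DISCHARGED at the zero-field torus instance (`B3Eq317ZeroTorus.G0xi_eq_rescaled`). [cite: Balaban1983Higgs3, (3.26) p.440, rescaling p.441] -/
theorem sum_gpiece_eq_smul_G0xi {a msq : ℝ} (ha : 0 < a) (hm : 0 ≤ msq) (hd : 2 ≤ P.d) {k : ℕ} (hk : 1 ≤ k) :
    (∑ i ∈ range k, gpiece P a msq k i) = fun y y' => P.spacing k ^ 2 / P.spacing k ^ P.d * G0xi P a msq k y y' := by
  funext y y'
  rw [G0xi_eq_rescaled ha hm hd hk y y']
  have hs : P.spacing k ≠ 0 := (P.spacing_pos k).ne'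
  have key : P.spacing k ^ 2 / P.spacing k ^ P.d * P.spacing k ^ (P.d - 2) = 1 := by
    rw [div_mul_eq_mul_div, ← pow_add, show 2 + (P.d - 2) = P.d by omega, div_self (pow_ne_zero _ hs)]
  rw [← mul_assoc, key, one_mul]

/-- p. 441 rescaling, the displacement: `(x′_ν − x_ν) = (L^kε)·(y′_ν − y_ν)` for the contour displacement of (3.26)
(`B3Eq317ZeroTorus.disp_rescale`) — the hypothesis `hdx` of r15's `Pi3_rescale` at the instance. [cite: Balaban1983Higgs3, (3.26) p.440, rescaling p.441] -/
theorem disp_eta_eq (k : ℕ) :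
    (fun (ν : Fin P.d) (x x' : Site P 0) => disp P.eps⁻¹ x x' ν) =
      fun ν x x' => P.spacing k * disp (P.eta k)⁻¹ x x' ν := by
  funext ν x x'
  rw [disp_rescale k x x' ν, ← mul_assoc, mul_inv_cancel₀ (P.spacing_pos k).ne', one_mul]

/-- **p. 441, the rescaling of `Π_{μμ′}` AT THE INSTANCE** (every `d ≥ 2`, every volume, `k ≥ 1`): *"Π^{(η,j₀)}_{μμ′}(x) =
(L^{j₀}η)^{−d+2}Π^{(L^{−j₀},j₀)}_{μμ′}(y), y = (L^{j₀}η)^{−1}x"* — `Π^{(η,k)}_{μμ′}[G^η_k(0)](x) = (L^kε)²/(L^kε)^d·Π^{(ξ,k)}_{μμ′}[G^ξ_k(0)](y)`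
(r15's `Pi2_rescale` with its three scaling hypotheses discharged by `sum_gpiece_eq_smul_G0xi`; `η = (L^kε)·ξ`).
[cite: Balaban1983Higgs3, (3.26) p.440, rescaling p.441] -/
theorem Pi2_eta_eq {a msq : ℝ} (ha : 0 < a) (hm : 0 ≤ msq) (hd : 2 ≤ P.d) {k : ℕ} (hk : 1 ≤ k) (τ : ℝ)
    (μ μ' : Fin P.d) (x : Site P 0) :
    Pi2 P.eps τ (∑ i ∈ range k, gpiece P a msq k i) (∑ i ∈ range k, gpiece P a msq k i)
        (∑ i ∈ range k, gpiece P a msq k i) μ μ' x =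
      P.spacing k ^ 2 / P.spacing k ^ P.d *
        Pi2 (P.eta k) τ (G0xi P a msq k) (G0xi P a msq k) (G0xi P a msq k) μ μ' x := by
  have h := sum_gpiece_eq_smul_G0xi ha hm hd hk (P := P)
  have hr := Pi2_rescale (P.spacing k) (P.eta k) τ (P.spacing_pos k).ne'
    (∑ i ∈ range k, gpiece P a msq k i) (∑ i ∈ range k, gpiece P a msq k i) (∑ i ∈ range k, gpiece P a msq k i)
    (G0xi P a msq k) (G0xi P a msq k) (G0xi P a msq k) h h h μ μ' x
  rwa [spacing_mul_eta] at hr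

/-- **p. 441, the rescaling of `Π_{μμ′ν}` AT THE INSTANCE** (every `d ≥ 2`, every volume, `k ≥ 1`): *"Π^{(η,j₀)}_{μμ′ν}(x) =
(L^{j₀}η)^{−d+3}Π^{(L^{−j₀},j₀)}_{μμ′ν}(y)"* — `Π^{(η,k)}_{μμ′ν}[G^η_k(0)](x) = (L^kε)³/(L^kε)^d·Π^{(ξ,k)}_{μμ′ν}[G^ξ_k(0)](y)` with the
contour displacement on both lattices (r15's `Pi3_rescale`, hypotheses discharged by `sum_gpiece_eq_smul_G0xi` and `disp_eta_eq`).
[cite: Balaban1983Higgs3, (3.26) p.440, rescaling p.441] -/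
theorem Pi3_eta_eq {a msq : ℝ} (ha : 0 < a) (hm : 0 ≤ msq) (hd : 2 ≤ P.d) {k : ℕ} (hk : 1 ≤ k) (τ : ℝ)
    (μ μ' ν : Fin P.d) (x : Site P 0) :
    Pi3 P.eps τ (∑ i ∈ range k, gpiece P a msq k i) (∑ i ∈ range k, gpiece P a msq k i)
        (fun ν x x' => disp P.eps⁻¹ x x' ν) μ μ' ν x =
      P.spacing k ^ 3 / P.spacing k ^ P.d *
        Pi3 (P.eta k) τ (G0xi P a msq k) (G0xi P a msq k) (fun ν x x' => disp (P.eta k)⁻¹ x x' ν) μ μ' ν x := by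
  have h := sum_gpiece_eq_smul_G0xi ha hm hd hk (P := P)
  have hr := Pi3_rescale (P.spacing k) (P.eta k) τ (P.spacing_pos k).ne'
    (∑ i ∈ range k, gpiece P a msq k i) (∑ i ∈ range k, gpiece P a msq k i) (G0xi P a msq k) (G0xi P a msq k) h h
    (fun ν x x' => disp P.eps⁻¹ x x' ν) (fun ν x x' => disp (P.eta k)⁻¹ x x' ν) (disp_eta_eq k) μ μ' ν x
  rwa [spacing_mul_eta] at hr

/-- **p. 441, d = 3: `Π^{(η,k)}_{μμ′}(x) = (L^kε)^{−1}·Π^{(ξ,k)}_{μμ′}(y)`** — *"We consider the case d = 3, so −d+2 = −1"*, at the instance.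
[cite: Balaban1983Higgs3, (3.26) p.440, rescaling p.441] -/
theorem Pi2_eta_eq_three {a msq : ℝ} (ha : 0 < a) (hm : 0 ≤ msq) (hd : P.d = 3) {k : ℕ} (hk : 1 ≤ k) (τ : ℝ)
    (μ μ' : Fin P.d) (x : Site P 0) :
    Pi2 P.eps τ (∑ i ∈ range k, gpiece P a msq k i) (∑ i ∈ range k, gpiece P a msq k i)
        (∑ i ∈ range k, gpiece P a msq k i) μ μ' x =
      (P.spacing k)⁻¹ * Pi2 (P.eta k) τ (G0xi P a msq k) (G0xi P a msq k) (G0xi P a msq k) μ μ' x := by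
  rw [Pi2_eta_eq ha hm (by omega) hk]
  have hs : P.spacing k ≠ 0 := (P.spacing_pos k).ne'
  have h3 : P.spacing k ^ P.d = P.spacing k ^ 2 * P.spacing k := by rw [hd]; ring
  rw [h3, div_mul_eq_div_div, div_self (pow_ne_zero _ hs), one_div]

/-- **p. 441, d = 3: `Π^{(η,k)}_{μμ′ν}(x) = Π^{(ξ,k)}_{μμ′ν}(y)`** — *"−d+3 = 0"*, at the instance. [cite: Balaban1983Higgs3, (3.26) p.440, rescaling p.441] -/
theorem Pi3_eta_eq_three {a msq : ℝ} (ha : 0 < a) (hm : 0 ≤ msq) (hd : P.d = 3) {k : ℕ} (hk : 1 ≤ k) (τ : ℝ)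
    (μ μ' ν : Fin P.d) (x : Site P 0) :
    Pi3 P.eps τ (∑ i ∈ range k, gpiece P a msq k i) (∑ i ∈ range k, gpiece P a msq k i)
        (fun ν x x' => disp P.eps⁻¹ x x' ν) μ μ' ν x =
      Pi3 (P.eta k) τ (G0xi P a msq k) (G0xi P a msq k) (fun ν x x' => disp (P.eta k)⁻¹ x x' ν) μ μ' ν x := by
  rw [Pi3_eta_eq ha hm (by omega) hk]
  have h3 : P.spacing k ^ P.d = P.spacing k ^ 3 := by rw [hd]
  rw [h3, div_self (pow_ne_zero _ (P.spacing_pos k).ne'), one_mul]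

end Rescaling

/-! ## §2 The two coefficients on the η-lattice, d = 3 -/

section Coefficients

/-- **p. 442: "the coefficient at the vertex [Π_{μμ′}] is proportional to (L^{j₀}η)^{−d+2}" — ON THE η-LATTICE, d = 3**, at the zero-field
torus instance: for odd `L > 1`, `a > 0`, `m² ≥ 0` there is `Cst > 0` (a function of `L, a, m²`) such that for EVERY volume
`P = (3, L, m, K)`, every `1 ≤ k ≤ K` (`k = j₀`), `τ = tr q²`, all `μ, μ′, x`:
`|Π^{(η,k)}_{μμ′}[G^η_k(0), G^η_k(0), G^η_k(0)](x)| ≤ Cst·(L^kε)^{−1}·|tr q²|` — the factor `(L^{j₀}η)^{−d+2} = (L^kε)^{−1}` times a function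
bounded uniformly in the volume and the scale (gen 8's `B3Pi2CxiTorusBounded.abs_Pi2_G0xi_le` transported by `Pi2_eta_eq_three`).
[cite: Balaban1983Higgs3, (3.30) p.442] -/
theorem abs_Pi2_eta_le (L : ℕ) (hL : Odd L ∧ 1 < L) {a : ℝ} (ha : 0 < a) {msq : ℝ} (hmsq : 0 ≤ msq) :
    ∃ Cst : ℝ, 0 < Cst ∧ ∀ (P : Params), P.d = 3 → P.L = L → ∀ k : ℕ, 1 ≤ k → k ≤ P.K →
      ∀ (τ : ℝ) (μ μ' : Fin P.d) (x : Site P 0),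
        |Pi2 P.eps τ (∑ i ∈ range k, gpiece P a msq k i) (∑ i ∈ range k, gpiece P a msq k i)
            (∑ i ∈ range k, gpiece P a msq k i) μ μ' x| ≤ Cst * (P.spacing k)⁻¹ * |τ| := by
  obtain ⟨Cst, hCst, H⟩ := B3Pi2CxiTorusBounded.abs_Pi2_G0xi_le L hL ha hmsq
  refine ⟨Cst, hCst, fun P hPd hPL k hk1 hkK τ μ μ' x => ?_⟩
  rw [Pi2_eta_eq_three ha hmsq hPd hk1, abs_mul, abs_of_pos (inv_pos.2 (P.spacing_pos k))]
  calc (P.spacing k)⁻¹ * |Pi2 (P.eta k) τ (G0xi P a msq k) (G0xi P a msq k) (G0xi P a msq k) μ μ' x|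
      ≤ (P.spacing k)⁻¹ * (Cst * |τ|) :=
        mul_le_mul_of_nonneg_left (H P hPd hPL k hk1 hkK τ μ μ' x) (inv_pos.2 (P.spacing_pos k)).le
    _ = Cst * (P.spacing k)⁻¹ * |τ| := by ring

/-- **p. 442, the same sentence in the form "proportional to (L^{j₀}η)^{−d+2}"**: with the constant of `abs_Pi2_eta_le`,
`Π^{(η,k)}_{μμ′}(x) = (L^kε)^{−1}·B` with `|B| ≤ Cst·|tr q²|` (`B = Π^{(ξ,k)}_{μμ′}(y)`, the rescaled coefficient of gen 8).
[cite: Balaban1983Higgs3, (3.30) p.442] -/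
theorem Pi2_eta_eq_bounded (L : ℕ) (hL : Odd L ∧ 1 < L) {a : ℝ} (ha : 0 < a) {msq : ℝ} (hmsq : 0 ≤ msq) :
    ∃ Cst : ℝ, 0 < Cst ∧ ∀ (P : Params), P.d = 3 → P.L = L → ∀ k : ℕ, 1 ≤ k → k ≤ P.K →
      ∀ (τ : ℝ) (μ μ' : Fin P.d) (x : Site P 0), ∃ B : ℝ, |B| ≤ Cst * |τ| ∧
        Pi2 P.eps τ (∑ i ∈ range k, gpiece P a msq k i) (∑ i ∈ range k, gpiece P a msq k i)
            (∑ i ∈ range k, gpiece P a msq k i) μ μ' x = (P.spacing k)⁻¹ * B := by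
  obtain ⟨Cst, hCst, H⟩ := B3Pi2CxiTorusBounded.abs_Pi2_G0xi_le L hL ha hmsq
  refine ⟨Cst, hCst, fun P hPd hPL k hk1 hkK τ μ μ' x => ⟨_, H P hPd hPL k hk1 hkK τ μ μ' x, ?_⟩⟩
  exact Pi2_eta_eq_three ha hmsq hPd hk1 τ μ μ' x

/-- **p. 442: "the coefficient at the vertex [Π_{μμ′ν}] is bounded" — ON THE η-LATTICE, d = 3**, at the zero-field torus instance:
for odd `L > 1`, `a > 0`, `m² ≥ 0` there is `Cst > 0` such that for EVERY volume `P = (3, L, m, K)`, every `1 ≤ k ≤ K`, `τ = tr q²`,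
all `μ, μ′, ν, x`: `|Π^{(η,k)}_{μμ′ν}[G^η_k(0), G^η_k(0)](x)| ≤ Cst·|tr q²|`, the displacement `(x′_ν − x_ν)` along `Γ_{x,x′}` on the
η-lattice (gen 8's `B3Pi3CxiTorusBounded.abs_Pi3_G0xi_le` transported by `Pi3_eta_eq_three`; `(L^{j₀}η)^{−d+3} = 1`).
[cite: Balaban1983Higgs3, (3.30) p.442] -/
theorem abs_Pi3_eta_le (L : ℕ) (hL : Odd L ∧ 1 < L) {a : ℝ} (ha : 0 < a) {msq : ℝ} (hmsq : 0 ≤ msq) :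
    ∃ Cst : ℝ, 0 < Cst ∧ ∀ (P : Params), P.d = 3 → P.L = L → ∀ k : ℕ, 1 ≤ k → k ≤ P.K →
      ∀ (τ : ℝ) (μ μ' ν : Fin P.d) (x : Site P 0),
        |Pi3 P.eps τ (∑ i ∈ range k, gpiece P a msq k i) (∑ i ∈ range k, gpiece P a msq k i)
            (fun ν x x' => disp P.eps⁻¹ x x' ν) μ μ' ν x| ≤ Cst * |τ| := by
  obtain ⟨Cst, hCst, H⟩ := B3Pi3CxiTorusBounded.abs_Pi3_G0xi_le L hL ha hmsq
  refine ⟨Cst, hCst, fun P hPd hPL k hk1 hkK τ μ μ' ν x => ?_⟩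
  rw [Pi3_eta_eq_three ha hmsq hPd hk1]
  exact H P hPd hPL k hk1 hkK τ μ μ' ν x

end Coefficients

/-! ## §3 The resummation over j, j′, j″ < j₀ and the two coefficients, at the instance -/

section Eq330

/-- kernel: at the instance the resummed kernel IS the sum of the pieces — (2.6) in the form `B3.Display26` consumed by
`B3Resummation315`. [cite: Balaban1983Higgs3, (2.6) p.424, (3.26) p.440] -/
theorem display26_gpiece (a msq : ℝ) (k : ℕ) :
    B3.Display26 (∑ i ∈ range k, gpiece P a msq k i) (fun i => gpiece P a msq k i) k := rfl

/-- **(3.26) → (3.30) AT THE ZERO-FIELD TORUS MODEL INSTANCE ON THE η-LATTICE, d = 3** — p. 440 *"If j₀ denotes a smallest j-index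
of external legs, then we sum with respect to j, j′, j″ from 0 to j₀ and we get the same expressions but with the propagator
G_{j₀}(0)"* and p. 442 *"where the coefficient at the vertex [Π_{μμ′ν}] is bounded, and the coefficient at the vertex [Π_{μμ′}] is
proportional to (L^{j₀}η)^{−d+2}"*: for odd `L > 1`, `a > 0`, `m² ≥ 0` there is ONE `Cst > 0` such that for EVERY volume
`P = (3, L, m, K)`, every `1 ≤ k ≤ K` (`k = j₀`), `τ = tr q²`, all `μ, μ′, ν, x`, with the Sect.-3 pieces `G^η_{(i)} = gpiece k i` and
`G^η_k(0) = Σ_{i<k}G^η_{(i)}`: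
(a) the nonlocal part of `Π_{μμ′}` summed over `0 ≤ i, i′ < k` minus its two local parts summed over `0 ≤ i″ < k` IS
`Π^{(η,k)}_{μμ′}[G^η_k(0)]` (`Pi2_resum`); (b) `Σ_{i,i′<k}Π_{μμ′ν}[G^η_{(i)}, G^η_{(i′)}] = Π^{(η,k)}_{μμ′ν}[G^η_k(0)]` (`Pi3_resum`);
(c) `|Π^{(η,k)}_{μμ′}[G^η_k(0)](x)| ≤ Cst·(L^kε)^{−1}·|tr q²|`; (d) `|Π^{(η,k)}_{μμ′ν}[G^η_k(0)](x)| ≤ Cst·|tr q²|`.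
[cite: Balaban1983Higgs3, (3.30) p.442] -/
theorem eq330_coefficients_zero_torus (L : ℕ) (hL : Odd L ∧ 1 < L) {a : ℝ} (ha : 0 < a) {msq : ℝ} (hmsq : 0 ≤ msq) :
    ∃ Cst : ℝ, 0 < Cst ∧ ∀ (P : Params), P.d = 3 → P.L = L → ∀ k : ℕ, 1 ≤ k → k ≤ P.K →
      ∀ (τ : ℝ) (μ μ' ν : Fin P.d) (x : Site P 0),
        ((∑ i ∈ range k, ∑ i' ∈ range k, ∑ x' : Site P 0,
              P.eps ^ P.d * kerC P.eps τ (gpiece P a msq k i) (gpiece P a msq k i') μ μ' x x')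
            - ∑ i'' ∈ range k, ((if μ = μ' then τ * gpiece P a msq k i'' x x else 0)
                + (if μ = μ' then τ * (P.eps * dAdjKernel P.eps⁻¹ μ (gpiece P a msq k i'') x x) else 0)) =
          Pi2 P.eps τ (∑ i ∈ range k, gpiece P a msq k i) (∑ i ∈ range k, gpiece P a msq k i)
            (∑ i ∈ range k, gpiece P a msq k i) μ μ' x) ∧
        (∑ i ∈ range k, ∑ i' ∈ range k,
            Pi3 P.eps τ (gpiece P a msq k i) (gpiece P a msq k i') (fun ν x x' => disp P.eps⁻¹ x x' ν) μ μ' ν x =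
          Pi3 P.eps τ (∑ i ∈ range k, gpiece P a msq k i) (∑ i ∈ range k, gpiece P a msq k i)
            (fun ν x x' => disp P.eps⁻¹ x x' ν) μ μ' ν x) ∧
        |Pi2 P.eps τ (∑ i ∈ range k, gpiece P a msq k i) (∑ i ∈ range k, gpiece P a msq k i)
            (∑ i ∈ range k, gpiece P a msq k i) μ μ' x| ≤ Cst * (P.spacing k)⁻¹ * |τ| ∧
        |Pi3 P.eps τ (∑ i ∈ range k, gpiece P a msq k i) (∑ i ∈ range k, gpiece P a msq k i)
            (fun ν x x' => disp P.eps⁻¹ x x' ν) μ μ' ν x| ≤ Cst * |τ| := by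
  obtain ⟨C₂, hC₂, H₂⟩ := abs_Pi2_eta_le L hL ha hmsq
  obtain ⟨C₃, hC₃, H₃⟩ := abs_Pi3_eta_le L hL ha hmsq
  refine ⟨max C₂ C₃, lt_max_of_lt_left hC₂, fun P hPd hPL k hk1 hkK τ μ μ' ν x => ⟨?_, ?_, ?_, ?_⟩⟩
  · exact Pi2_resum P.eps τ (display26_gpiece a msq k) μ μ' x
  · exact Pi3_resum P.eps τ (display26_gpiece a msq k) (fun ν x x' => disp P.eps⁻¹ x x' ν) μ μ' ν x
  · refine (H₂ P hPd hPL k hk1 hkK τ μ μ' x).trans ?_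
    have h0 : 0 ≤ (P.spacing k)⁻¹ * |τ| := by have := P.spacing_pos k; positivity
    calc C₂ * (P.spacing k)⁻¹ * |τ| = C₂ * ((P.spacing k)⁻¹ * |τ|) := by ring
      _ ≤ max C₂ C₃ * ((P.spacing k)⁻¹ * |τ|) := mul_le_mul_of_nonneg_right (le_max_left _ _) h0
      _ = max C₂ C₃ * (P.spacing k)⁻¹ * |τ| := by ring
  · exact (H₃ P hPd hPL k hk1 hkK τ μ μ' ν x).trans (mul_le_mul_of_nonneg_right (le_max_right _ _) (abs_nonneg τ))

/-- **The same coefficients with the (L^kε)-factor estimated away where it is harmless**: since `L^kε ≤ 1` (`k ≤ K`), the η-lattice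
`Π_{μμ′ν}`-coefficient is bounded by `Cst|tr q²|` and the `Π_{μμ′}`-coefficient by `Cst(L^kε)^{−1}|tr q²| ≥ Cst|tr q²|·1` — recorded as
the one-sided comparison `Cst·|τ| ≤ Cst·(L^kε)^{−1}·|τ|` (the divergence of the two-leg vertex as `L^kε → 0` is the content of the
word "proportional"; the paper cancels it by the Ward–Takahashi identity, gens 7–9). [cite: Balaban1983Higgs3, (3.30) p.442] -/
theorem coefficient_scales {Cst τ : ℝ} (hC : 0 ≤ Cst) {k : ℕ} (hk : k ≤ P.K) :
    Cst * |τ| ≤ Cst * (P.spacing k)⁻¹ * |τ| := by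
  have hs := P.spacing_pos k
  have hs1 : P.spacing k ≤ 1 := spacing_le_one P hk
  have hinv : 1 ≤ (P.spacing k)⁻¹ := one_le_inv_iff₀.2 ⟨hs, hs1⟩
  calc Cst * |τ| = Cst * 1 * |τ| := by ring
    _ ≤ Cst * (P.spacing k)⁻¹ * |τ| := by gcongr

end Eq330

/-! ## §4 The two vertices of (3.30): the square bracket and the first curly bracket of (3.26) on the η-lattice -/

section Vertices

/-- **THE TWO-LEG VERTEX OF (3.30)** (the square bracket of (3.26) after the resummation, *"Σ_xη^dΣ_{μ,μ′}g(x)A_μ(x)Π^{(η,j₀)}_{μμ′}(x)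
g′(x)A′_{μ′}(x)"*, r15's `bracket326_eq_Pi2`) ON THE η-LATTICE at the instance, d = 3: for odd `L > 1`, `a > 0`, `m² ≥ 0` there is
`Cst > 0` with `|[square bracket of (3.26)](G^η_k(0))| ≤ Cst·(L^kε)^{−1}·|tr q²|·Σ_xη³Σ_{μμ′}|g(x)A_μ(x)|·|g′(x)A′_{μ′}(x)|` for every
volume, every `1 ≤ k ≤ K`, all legs `g, g′, A, A′` — a local two-vector-leg vertex with coefficient *"proportional to
(L^{j₀}η)^{−d+2}"*. [cite: Balaban1983Higgs3, (3.30) p.442] -/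
theorem abs_bracket326_eta_le (L : ℕ) (hL : Odd L ∧ 1 < L) {a : ℝ} (ha : 0 < a) {msq : ℝ} (hmsq : 0 ≤ msq) :
    ∃ Cst : ℝ, 0 < Cst ∧ ∀ (P : Params), P.d = 3 → P.L = L → ∀ k : ℕ, 1 ≤ k → k ≤ P.K →
      ∀ (τ : ℝ) (g g' : SiteField P 0 ℝ) (A A' : VecField P 0 ℝ),
        |bracket326 P.eps τ (∑ i ∈ range k, gpiece P a msq k i) (∑ i ∈ range k, gpiece P a msq k i)
            (∑ i ∈ range k, gpiece P a msq k i) g g' A A'| ≤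
          Cst * (P.spacing k)⁻¹ * |τ| *
            ∑ x : Site P 0, P.eps ^ P.d * ∑ μ : Fin P.d, ∑ μ' : Fin P.d, |g x * A ⟨x, μ⟩| * |g' x * A' ⟨x, μ'⟩| := by
  obtain ⟨Cst, hCst, H⟩ := abs_Pi2_eta_le L hL ha hmsq
  refine ⟨Cst, hCst, fun P hPd hPL k hk1 hkK τ g g' A A' => ?_⟩
  set G := ∑ i ∈ range k, gpiece P a msq k i with hG
  set Kc : ℝ := Cst * (P.spacing k)⁻¹ * |τ| with hKc
  have he : (0 : ℝ) ≤ P.eps ^ P.d := pow_nonneg P.eps_pos.le _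
  have hK0 : 0 ≤ Kc := by have := P.spacing_pos k; positivity
  have hpt : ∀ (x : Site P 0) (μ μ' : Fin P.d),
      |g x * A ⟨x, μ⟩ * Pi2 P.eps τ G G G μ μ' x * (g' x * A' ⟨x, μ'⟩)| ≤ Kc * (|g x * A ⟨x, μ⟩| * |g' x * A' ⟨x, μ'⟩|) := by
    intro x μ μ'
    have hb := H P hPd hPL k hk1 hkK τ μ μ' x
    rw [abs_mul, abs_mul]
    calc |g x * A ⟨x, μ⟩| * |Pi2 P.eps τ G G G μ μ' x| * |g' x * A' ⟨x, μ'⟩|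
        ≤ |g x * A ⟨x, μ⟩| * Kc * |g' x * A' ⟨x, μ'⟩| := by gcongr
      _ = Kc * (|g x * A ⟨x, μ⟩| * |g' x * A' ⟨x, μ'⟩|) := by ring
  rw [bracket326_eq_Pi2]
  calc |∑ x : Site P 0, P.eps ^ P.d * ∑ μ : Fin P.d, ∑ μ' : Fin P.d,
          g x * A ⟨x, μ⟩ * Pi2 P.eps τ G G G μ μ' x * (g' x * A' ⟨x, μ'⟩)|
      ≤ ∑ x : Site P 0, P.eps ^ P.d * ∑ μ : Fin P.d, ∑ μ' : Fin P.d, Kc * (|g x * A ⟨x, μ⟩| * |g' x * A' ⟨x, μ'⟩|) := by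
        refine (Finset.abs_sum_le_sum_abs _ _).trans (Finset.sum_le_sum fun x _ => ?_)
        rw [abs_mul, abs_of_nonneg he]
        refine mul_le_mul_of_nonneg_left ?_ he
        refine (Finset.abs_sum_le_sum_abs _ _).trans (Finset.sum_le_sum fun μ _ => ?_)
        exact (Finset.abs_sum_le_sum_abs _ _).trans (Finset.sum_le_sum fun μ' _ => hpt x μ μ')
    _ = Kc * ∑ x : Site P 0, P.eps ^ P.d * ∑ μ : Fin P.d, ∑ μ' : Fin P.d, |g x * A ⟨x, μ⟩| * |g' x * A' ⟨x, μ'⟩| := by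
        simp only [Finset.mul_sum]
        exact Finset.sum_congr rfl fun x _ => Finset.sum_congr rfl fun μ _ => Finset.sum_congr rfl fun μ' _ => by ring

/-- **THE THREE-LEG VERTEX OF (3.30)** (the first curly bracket of (3.26) after the resummation, *"Σ_νΣ_xη^dΣ_{μ,μ′}g(x)A_μ(x)
Π^{(η,j₀)}_{μμ′ν}(x)(∂^η_νg′A′_{μ′})(x)"*, r15's `curly1_eq_Pi3`) ON THE η-LATTICE at the instance, d = 3: for odd `L > 1`, `a > 0`,
`m² ≥ 0` there is `Cst > 0` with `|{first curly bracket of (3.26)}(G^η_k(0))| ≤ Cst·|tr q²|·Σ_νΣ_xη³Σ_{μμ′}|g(x)A_μ(x)|·|D_{νμ′}(x)|` for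
every volume, every `1 ≤ k ≤ K`, all legs `g, A` and every reading `D` of the differentiated leg (in print `D_{νμ′} = ∂^η_ν(g′A′_{μ′})`)
— a local vertex with a BOUNDED coefficient. [cite: Balaban1983Higgs3, (3.30) p.442] -/
theorem abs_curly1_eta_le (L : ℕ) (hL : Odd L ∧ 1 < L) {a : ℝ} (ha : 0 < a) {msq : ℝ} (hmsq : 0 ≤ msq) :
    ∃ Cst : ℝ, 0 < Cst ∧ ∀ (P : Params), P.d = 3 → P.L = L → ∀ k : ℕ, 1 ≤ k → k ≤ P.K →
      ∀ (τ : ℝ) (g : SiteField P 0 ℝ) (A : VecField P 0 ℝ) (D : Fin P.d → Fin P.d → SiteField P 0 ℝ),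
        |curly1 P.eps τ (∑ i ∈ range k, gpiece P a msq k i) (∑ i ∈ range k, gpiece P a msq k i) g A
            (fun ν x x' => disp P.eps⁻¹ x x' ν) D| ≤
          Cst * |τ| * ∑ ν : Fin P.d, ∑ x : Site P 0, P.eps ^ P.d *
            ∑ μ : Fin P.d, ∑ μ' : Fin P.d, |g x * A ⟨x, μ⟩| * |D ν μ' x| := by
  obtain ⟨Cst, hCst, H⟩ := abs_Pi3_eta_le L hL ha hmsq
  refine ⟨Cst, hCst, fun P hPd hPL k hk1 hkK τ g A D => ?_⟩
  set G := ∑ i ∈ range k, gpiece P a msq k i with hG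
  set Dx : Fin P.d → Site P 0 → Site P 0 → ℝ := fun ν x x' => disp P.eps⁻¹ x x' ν with hDx
  set Kc : ℝ := Cst * |τ| with hKc
  have he : (0 : ℝ) ≤ P.eps ^ P.d := pow_nonneg P.eps_pos.le _
  have hK0 : 0 ≤ Kc := by positivity
  have hpt : ∀ (ν : Fin P.d) (x : Site P 0) (μ μ' : Fin P.d),
      |g x * A ⟨x, μ⟩ * Pi3 P.eps τ G G Dx μ μ' ν x * D ν μ' x| ≤ Kc * (|g x * A ⟨x, μ⟩| * |D ν μ' x|) := by
    intro ν x μ μ'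
    have hb := H P hPd hPL k hk1 hkK τ μ μ' ν x
    rw [abs_mul, abs_mul]
    calc |g x * A ⟨x, μ⟩| * |Pi3 P.eps τ G G Dx μ μ' ν x| * |D ν μ' x|
        ≤ |g x * A ⟨x, μ⟩| * Kc * |D ν μ' x| := by gcongr
      _ = Kc * (|g x * A ⟨x, μ⟩| * |D ν μ' x|) := by ring
  rw [curly1_eq_Pi3]
  calc |∑ ν : Fin P.d, ∑ x : Site P 0, P.eps ^ P.d * ∑ μ : Fin P.d, ∑ μ' : Fin P.d,
          g x * A ⟨x, μ⟩ * Pi3 P.eps τ G G Dx μ μ' ν x * D ν μ' x|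
      ≤ ∑ ν : Fin P.d, ∑ x : Site P 0, P.eps ^ P.d * ∑ μ : Fin P.d, ∑ μ' : Fin P.d, Kc * (|g x * A ⟨x, μ⟩| * |D ν μ' x|) := by
        refine (Finset.abs_sum_le_sum_abs _ _).trans (Finset.sum_le_sum fun ν _ => ?_)
        refine (Finset.abs_sum_le_sum_abs _ _).trans (Finset.sum_le_sum fun x _ => ?_)
        rw [abs_mul, abs_of_nonneg he]
        refine mul_le_mul_of_nonneg_left ?_ he
        refine (Finset.abs_sum_le_sum_abs _ _).trans (Finset.sum_le_sum fun μ _ => ?_)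
        exact (Finset.abs_sum_le_sum_abs _ _).trans (Finset.sum_le_sum fun μ' _ => hpt ν x μ μ')
    _ = Kc * ∑ ν : Fin P.d, ∑ x : Site P 0, P.eps ^ P.d *
          ∑ μ : Fin P.d, ∑ μ' : Fin P.d, |g x * A ⟨x, μ⟩| * |D ν μ' x| := by
        simp only [Finset.mul_sum]
        exact Finset.sum_congr rfl fun ν _ => Finset.sum_congr rfl fun x _ =>
          Finset.sum_congr rfl fun μ _ => Finset.sum_congr rfl fun μ' _ => by ring

end Vertices

end

end Literature.MathematicalPhysics.QuantumFieldTheory.Balaban1983to89.B3Eq330EtaZeroTorus
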